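import Summits.CriticalPhenomena.SAWScalingLimit.Theorems.SAWCompassLatticeSurfaceUniversalityGlueV7
import Summits.CriticalPhenomena.SAWScalingLimit.Theorems.SAWCompassLatticeSurfaceUniversalityLipPlusIsUnif

/-!
# Route-level SPLIT of the crux `SAWCompassLattice.SurfaceUniversality` (stmt-CriticalPhenomena-6964):
# the glue `children ⟹ crux`, proved from landed theorems

Crux-strategist s2 (gen 1), `--supports stmt-CriticalPhenomena-6964` (registered stub
`SurfaceUniversality_of_subs`). Three lead cycles (c1–c3) and strategist s1 reduced the crux to THREE
research-level statements with every seam proved and landed (`…SurfaceUniversalityTightToll` p145113,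
`…Defs` p150257, `…LipPlusIsUnif` p151088, `…GlueV7` p170993); no provable piece of the registered
line (`Cruxes/SurfaceUniversality/Lines/birth.lean`, skeleton v7) remains. This file proves the glue of
the corresponding ROUTE-LEVEL split (`ledger route edit … --split SurfaceUniversality`), whose three
children are, as route items over Literature vocabulary only:

* `TightZ2` := the signature of item stmt-CriticalPhenomena-1881 verbatim (= `SAWParafermion.EventualTight`
  by `Iff.rfl`): eventual tightness of the critical `ℤ²` SAW curve laws;
* `PlusPointIsZ2` := `LipPlusPointIsZ2` with `plusLaw` unfolded (`plusLaw_eq_pathLaw`, `rfl`) — verbatim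
  the registered stub `stub_lipPlusPointIsZ2` of the sibling crux stmt-CriticalPhenomena-16966: critical
  `ℤ²` law vs critical plus-lattice law between ports, on bounded Lipschitz observables (independence
  of the lattice approximation: contains stmt-0776 at Lipschitz level and inward boundary-layer
  robustness; implied by the lead's v7 statement, `GlueV7.glue7_lipPlusPointIsZ2`);
* `UniversalityKernel` := `LipPlusToYB` with `plusLaw` unfolded — verbatim the registered stub
  `stub_lipPlusToYB` of stmt-16966: critical plus law vs Glazman–Manolescu's critical Yang–Baxter law
  `ybLaw (π/2) · · 1` between the same ports, on bounded Lipschitz observables — THE KERNEL (planar SAW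
  universality between the uniform and the integrable `n = 0` point of the square lattice). It is
  EQUIVALENT to the lead's kernel stub `LipUnifToYB` through the landed plus dictionary
  (`lipPlusToYB_iff_lipUnifToYB` below), so one proof closes either spelling.

Main theorems: `SurfaceUniversality_of_subs : SAWParafermion.EventualTight → LipPlusPointIsZ2 →
LipPlusToYB → SAWCompassLattice.SurfaceUniversality` (registered stub; proof =
`surfaceUniversality_of_tight_of_lipMerge ∘ lipYBtoUniform_of_lipPlus`); its item-level spelling
`SurfaceUniversality_of_subs_items` (the three children written out exactly as route items — the
generated glue item `TightZ2 → PlusPointIsZ2 → UniversalityKernel → SurfaceUniversality` is closed by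
`fun hT hZ hK => SurfaceUniversality_of_subs_items hT hZ hK`, definitional unfolding only); the same
children give the sibling crux (`YBtoUniform_of_subs : … → SAWTrackTransport.YBtoUniform`); and the
orientation lemmas `lipPlusToYB_iff_lipUnifToYB`, `lipPlusToYB_of_ybToUniform`.
No new definition, no new hypothesis, no `sorry`. [folklore] bookkeeping on the tree's own objects.
-/

noncomputable section

namespace Summit.CriticalPhenomena.SAWScalingLimit.Theorems.SurfaceUniversality.Split

open MeasureTheory Filter Topology Set
open scoped NNReal ENNReal BoundedContinuousFunction
open Literature.Probability.RandomPlanarGeometry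
open Literature.Probability.RandomPlanarGeometry.SAW
open Literature.Probability.RandomPlanarGeometry.SAW.YangBaxter
open Literature.Probability.LatticeModels (Site)
open Summit.CriticalPhenomena.SAWScalingLimit.Theses

/-! ### The glue: children ⟹ crux, BY NAME -/

/-- **SPLIT GLUE** (registered stub `SurfaceUniversality_of_subs` of stmt-CriticalPhenomena-6964):
`EventualTight → LipPlusPointIsZ2 → LipPlusToYB → SAWCompassLattice.SurfaceUniversality` — the
Lipschitz mergings `(∫dP^{ℤ²} − ∫dPlus) + (∫dPlus − ∫dYB)` (`lipYBtoUniform_of_lipPlus`) upgraded by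
one-sided Prokhorov tightness of the `ℤ²` side and composed with the proved Lipschitz port coupling
YB ↔ compass (`surfaceUniversality_of_tight_of_lipMerge`). [folklore] -/
theorem SurfaceUniversality_of_subs :
    SAWParafermion.EventualTight → LipPlusPointIsZ2 → LipPlusToYB → SAWCompassLattice.SurfaceUniversality :=
  fun hT hZ hK => surfaceUniversality_of_tight_of_lipMerge hT (lipYBtoUniform_of_lipPlus hZ hK)

/-- The same glue with the three children WRITTEN OUT exactly as the route items `TightZ2`,
`PlusPointIsZ2`, `UniversalityKernel` of the split (Literature vocabulary only; each is definitionally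
the named statement above: `Iff.rfl` / `plusLaw_eq_pathLaw`). The generated route glue item
`TightZ2 → PlusPointIsZ2 → UniversalityKernel → SurfaceUniversality` is this statement after unfolding
the three route `def`s. [folklore] -/
theorem SurfaceUniversality_of_subs_items :
    (∀ (D : Literature.Probability.RandomPlanarGeometry.DobrushinDomain) (a b : ℝ → Literature.Probability.LatticeModels.Site 2), Literature.Probability.RandomPlanarGeometry.SAW.IsEndpointApprox D a b → Literature.Probability.RandomPlanarGeometry.IsTightAlongMesh (fun δ (γ : Literature.Probability.RandomPlanarGeometry.SAW.DomainSAW D.carrier δ (a δ) (b δ)) => γ.curve) (fun δ => Literature.Probability.RandomPlanarGeometry.SAW.law D.carrier δ (a δ) (b δ))) →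
    (∀ (D : DobrushinDomain) (a b : ℝ → Literature.Probability.LatticeModels.Site 2) (a' b' : ℝ → MidEdge), SAW.IsEndpointApprox D a b → IsYBEndpointApprox rightAngles D a' b' → ∀ (f : BoundedContinuousFunction (CurveClass ℂ) ℝ) (L : NNReal), LipschitzWith L f → Filter.Tendsto (fun δ : ℝ => (∫ γ, f γ.curve ∂(SAW.law D.carrier δ (a δ) (b δ))) - ∫ x, f x ∂(PortGadget.pathLaw plusLattice (plusFugacity (Real.sqrt SAW.criticalFugacity)) (PortGadget.embed plusPos) (PortGadget.inFaces (meshFaces rightAngles D.carrier δ)) δ (Sum.inl (a' δ)) (Sum.inl (b' δ)))) (nhdsWithin 0 (Set.Ioi 0)) (nhds 0)) →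
    (∀ (D : DobrushinDomain) (a' b' : ℝ → MidEdge), IsYBEndpointApprox rightAngles D a' b' → ∀ (f : BoundedContinuousFunction (CurveClass ℂ) ℝ) (L : NNReal), LipschitzWith L f → Filter.Tendsto (fun δ : ℝ => (∫ x, f x ∂(PortGadget.pathLaw plusLattice (plusFugacity (Real.sqrt SAW.criticalFugacity)) (PortGadget.embed plusPos) (PortGadget.inFaces (meshFaces rightAngles D.carrier δ)) δ (Sum.inl (a' δ)) (Sum.inl (b' δ)))) - ∫ γ, f (γ.curve rightAngles δ) ∂(ybLaw rightAngles D.carrier δ 1 (a' δ) (b' δ))) (nhdsWithin 0 (Set.Ioi 0)) (nhds 0)) →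
    SAWCompassLattice.SurfaceUniversality :=
  SurfaceUniversality_of_subs

/-- **The same children give the sibling crux** `SAWTrackTransport.YBtoUniform`
(stmt-CriticalPhenomena-16966, whose registered stubs `stub_tightZ2`, `stub_lipPlusPointIsZ2`,
`stub_lipPlusToYB` are literally these three hypotheses): `ybToUniform_of_tight_of_lipMerge`. So the
split filed on route SAWCompassLattice serves route SAWTrackTransport verbatim. [folklore] -/
theorem YBtoUniform_of_subs :
    SAWParafermion.EventualTight → LipPlusPointIsZ2 → LipPlusToYB → SAWTrackTransport.YBtoUniform :=
  fun hT hZ hK => ybToUniform_of_tight_of_lipMerge hT (lipYBtoUniform_of_lipPlus hZ hK)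

/-! ### Orientation of the kernel child -/

/-- The kernel child `LipPlusToYB` (plus law vs YB law) is EQUIVALENT to the lead's kernel stub
`LipUnifToYB` (uniform-fugacity face walk vs YB law, skeleton v7 `stub_lipUnifToYB`), through the
landed plus dictionary `lipPlusIsUnif` (`(∫dPlus − ∫dYB) − (∫dPlus − ∫dUnif) = ∫dUnif − ∫dYB`).
A proof of either spelling closes the kernel. [folklore] -/
theorem lipPlusToYB_iff_lipUnifToYB : LipPlusToYB ↔ LipUnifToYB := by
  refine ⟨fun hK D a' b' hab' f L hf => ?_, lipPlusToYB_of_unif lipPlusIsUnif⟩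
  have h := (hK D a' b' hab' f L hf).sub (lipPlusIsUnif D.carrier a' b' f L hf)
  rw [sub_zero] at h
  refine h.congr fun δ => ?_
  ring

/-- Inside the route the toll gives the kernel back modulo the `ℤ²`-side child (unconditionally, from
the landed `lipYBtoUniform_of_ybToUniform` and `lipUnifToYB_of_lipYBtoUniform`):
`YBtoUniform → LipPlusPointIsZ2 → LipPlusToYB`. With `YBtoUniform_of_subs`: given `EventualTight` and
`LipPlusPointIsZ2`, the kernel child is EQUIVALENT to the sibling crux `YBtoUniform`. [folklore] -/
theorem lipPlusToYB_of_ybToUniform (hU : SAWTrackTransport.YBtoUniform) (hZ : LipPlusPointIsZ2) :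
    LipPlusToYB :=
  lipPlusToYB_iff_lipUnifToYB.2
    (lipUnifToYB_of_lipYBtoUniform (lipYBtoUniform_of_ybToUniform hU) hZ lipPlusIsUnif)

/-- Given the two `ℤ²`-side children, the kernel child and the sibling crux coincide:
`EventualTight → LipPlusPointIsZ2 → (LipPlusToYB ↔ YBtoUniform)`. [folklore] -/
theorem lipPlusToYB_iff_ybToUniform (hT : SAWParafermion.EventualTight) (hZ : LipPlusPointIsZ2) :
    LipPlusToYB ↔ SAWTrackTransport.YBtoUniform :=
  ⟨fun hK => YBtoUniform_of_subs hT hZ hK, fun hU => lipPlusToYB_of_ybToUniform hU hZ⟩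

end Summit.CriticalPhenomena.SAWScalingLimit.Theorems.SurfaceUniversality.Split

end
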